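import Literature.NumberTheory.EllipticCurves.KodairaNeronMultiplicativeProofs
import Literature.NumberTheory.EllipticCurves.HasseWeilGoodReductionFrobeniusProofs
import HarnessLib

/-!
# At a place of multiplicative reduction the inertia group fixes `√γ(E/K)`, `γ = −c₄/c₆`
# (the quadratic twist `K_v(√γ)/K_v` attached to Tate's uniformisation is unramified)

`Proofs` file (theorems only: **no definition, no named fact, nothing asserted**) in topic
`NumberTheory/EllipticCurves/TateCurve`. Source: J. H. Silverman, *Advanced Topics in the
Arithmetic of Elliptic Curves*, GTM 151 (1994), Ch. V, Lemma 5.2, Thm. 5.3 and Exercise 5.11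
(held copy `book:silverman1994-advanced-topics-arithmetic-elliptic-curves`, PDF pp. 406–410): for
`E/K_v` with `|j|_v > 1` and `γ = γ(E/K) = −c₄/c₆ ∈ K_v^*/K_v^{*2}`, `E` is the quadratic twist of
the Tate curve `E_q` by `K_v(√γ)/K_v`, and "`E` has split multiplicative reduction iff `γ ∈ K_v^{*2}`",
"`E` has multiplicative reduction iff `K_v(√γ)/K_v` is unramified", "additive iff ramified". The
tree's twisted uniformisation `Silverman1994_thmV53_corV54_tateUniformisation` (PROVED,
`TateCurve/NumberFieldUniformizationTwisted`) is equivariant only up to the sign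
`χ(σ) = σ(t)/t`, `t² = γ`; its consumers (b2b's Tate datum `X2.GreenbergVatsalTateDatum`, hypothesis
`ht`; the TOWER road's local kernels at multiplicative places, seat `bsd-2adic-tower-1`) need
**`σ t = t` for `σ` in the inertia group**, which the tree had only for `K = ℚ`
(`X2.GreenbergVatsalTateDatumRat.inertia_fix_sqrt_gamma`, odd `p`; `X2.TateTwistUnramifiedAtTwo`,
`p = 2`). This file proves it for every number field `K` and every finite place `v`:

* `toAlgEquiv_eq_of_mem_inertia_of_sq_eq_gamma`: `W` elliptic over `K` with multiplicative
  reduction at `v`, `t ∈ K̄_v` with `t² = −c₄(W)/c₆(W)`, `σ ∈ I_𝔐` ⇒ `σ t = t`.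

Proof. Pass to the minimal model `M` at `v` (`C • W_{K_v} = M`, so `γ(W) = u_C^{−2} γ(M)` and
`t = s/u_C` with `s² = γ(M) = −c₄(M)/c₆(M)`); `c₄(M)`, `c₆(M)` are `v`-units (Silverman *AEC*
VII.5.1 (b); `1728Δ = c₄³ − c₆²`). An element of `I_𝔐` moves `v`-integral elements by less than
`1` (`mem_inertia_iff_spectralValuation`) and sends `s` to `±s`.
(i) `v ∤ 2`: `|s|_v = 1`, so `σ s = −s` would give `|σ s − s|_v = |2s|_v = 1`.
(ii) `v ∣ 2`: for every Weierstrass equation `−c₄c₆ = a₁^{10} + 4T` and `c₄ = a₁⁴ + 2T'` with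
`T, T'` integral polynomials in the `aᵢ` (`neg_c₄_mul_c₆_eq`, `c₄_eq_a₁_pow_four_add_two_mul`;
Silverman *AEC* III §1), so `c₄ ∈ 𝓞_v^×` forces `a₁ ∈ 𝓞_v^×` and `s' = s·c₆/a₁⁵` has
`s'² = 1 + 4δ`, `δ = T/a₁^{10}` integral; then `x = (1 + s')/2` is a root of `X² − X − δ`, hence
`v`-integral, and `σ s' = −s'` would give `|σ x − x|_v = |s'|_v = 1` — the argument of
`X2.TateTwistUnramifiedAtTwo` over `ℚ`, where `−c₄c₆ ≡ 1 (mod 4)`.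

## References

* [SilvermanATAEC1994] J. H. Silverman, *Advanced Topics in the Arithmetic of Elliptic Curves*,
  GTM 151 (1994), Ch. V Lemma 5.2, Thm. 5.3, Cor. 5.4, Ex. 5.11 (PDF pp. 406–412).
* [SilvermanAEC2009] J. H. Silverman, *The Arithmetic of Elliptic Curves*, 2nd ed. (2009), III §1
  (`b₂, b₄, b₆, c₄, c₆`), Prop. VII.5.1 (b).
* [NeukirchANT1999] J. Neukirch, *Algebraic Number Theory* (1999), Ch. II (9.3) (inertia group).

## Design

No definitions; `noncomputable section`; `open scoped Classical NNReal`; one universe `u`; the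
spectral valuation is quantified with `hw` as in `SelmerFiniteProofs`. Axioms: `propext`,
`Classical.choice`, `Quot.sound`.
-/

noncomputable section

open scoped Classical NNReal
open NumberField IsDedekindDomain Field IsLocalRing

universe u

namespace WeierstrassCurve

/-- **`−c₄c₆ ≡ a₁^{10} (mod 4)` as a polynomial identity**: for every Weierstrass equation,
`−c₄c₆ = a₁^{10} + 4·T(a₁,…,a₆)` with the displayed integral polynomial `T` (expand
`c₄ = b₂² − 24b₄`, `c₆ = −b₂³ + 36b₂b₄ − 216b₆`, `b₂ = a₁² + 4a₂`). Deliberate dot-notation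
extension of Mathlib's `WeierstrassCurve`. [cite: SilvermanAEC2009, III §1 (b₂, b₄, b₆, c₄, c₆)] -/
theorem neg_c₄_mul_c₆_eq {S : Type*} [CommRing S] (W : WeierstrassCurve S) :
    -(W.c₄ * W.c₆) = W.a₁ ^ 10 + 4 * (5 * W.a₁ ^ 8 * W.a₂ - 15 * W.a₁ ^ 7 * W.a₃
      + 40 * W.a₁ ^ 6 * W.a₂ ^ 2 - 30 * W.a₁ ^ 6 * W.a₄ - 180 * W.a₁ ^ 5 * W.a₂ * W.a₃
      + 160 * W.a₁ ^ 4 * W.a₂ ^ 3 - 360 * W.a₁ ^ 4 * W.a₂ * W.a₄ + 270 * W.a₁ ^ 4 * W.a₃ ^ 2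
      + 216 * W.a₁ ^ 4 * W.a₆ - 720 * W.a₁ ^ 3 * W.a₂ ^ 2 * W.a₃ + 864 * W.a₁ ^ 3 * W.a₃ * W.a₄
      + 320 * W.a₁ ^ 2 * W.a₂ ^ 4 - 1440 * W.a₁ ^ 2 * W.a₂ ^ 2 * W.a₄
      + 1296 * W.a₁ ^ 2 * W.a₂ * W.a₃ ^ 2 + 1728 * W.a₁ ^ 2 * W.a₂ * W.a₆ + 864 * W.a₁ ^ 2 * W.a₄ ^ 2
      - 960 * W.a₁ * W.a₂ ^ 3 * W.a₃ + 3456 * W.a₁ * W.a₂ * W.a₃ * W.a₄ - 1296 * W.a₁ * W.a₃ ^ 3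
      - 5184 * W.a₁ * W.a₃ * W.a₆ + 256 * W.a₂ ^ 5 - 1920 * W.a₂ ^ 3 * W.a₄ + 864 * W.a₂ ^ 2 * W.a₃ ^ 2
      + 3456 * W.a₂ ^ 2 * W.a₆ + 3456 * W.a₂ * W.a₄ ^ 2 - 2592 * W.a₃ ^ 2 * W.a₄
      - 10368 * W.a₄ * W.a₆) := by
  simp only [WeierstrassCurve.c₄, WeierstrassCurve.c₆, WeierstrassCurve.b₂, WeierstrassCurve.b₄,
    WeierstrassCurve.b₆]
  ring

/-- **`c₄ ≡ a₁⁴ (mod 2)` as a polynomial identity**: `c₄ = a₁⁴ + 2(4a₁²a₂ + 8a₂² − 24a₄ − 12a₁a₃)`.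
Deliberate dot-notation extension of Mathlib's `WeierstrassCurve`.
[cite: SilvermanAEC2009, III §1 (b₂, b₄, c₄)] -/
theorem c₄_eq_a₁_pow_four_add_two_mul {S : Type*} [CommRing S] (W : WeierstrassCurve S) :
    W.c₄ = W.a₁ ^ 4 + 2 * (4 * W.a₁ ^ 2 * W.a₂ + 8 * W.a₂ ^ 2 - 24 * W.a₄ - 12 * W.a₁ * W.a₃) := by
  simp only [WeierstrassCurve.c₄, WeierstrassCurve.b₂, WeierstrassCurve.b₄]
  ring

end WeierstrassCurve

namespace Literature.NumberTheory.EllipticCurves.TateCurve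

open Literature.NumberTheory.EllipticCurves Literature.NumberTheory.GaloisRepresentations
  _root_.IsDedekindDomain.HeightOneSpectrum _root_.WeierstrassCurve

variable {K : Type u} [Field K] [NumberField K] {v : HeightOneSpectrum (𝓞 K)}
  {w : Valuation (AlgebraicClosure (v.adicCompletion K)) ℝ≥0}
  (hw : ∀ x, (w x : ℝ) = spectralNorm (v.adicCompletion K) (AlgebraicClosure (v.adicCompletion K)) x)

/-! ## Local lemmas in `K̄_v` -/

/-- A square root `s` of a `σ`-fixed element is sent by the field automorphism `σ` to `±s`
(`(σs)² = s²` in a field). [folklore] -/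
private theorem algEquiv_eq_or_eq_neg_of_sq {L : Type*} [Field L] {F : Type*} [Field F]
    [Algebra F L] (σ : L ≃ₐ[F] L) {s : L} (hs : σ (s ^ 2) = s ^ 2) : σ s = s ∨ σ s = -s := by
  have h : (σ s - s) * (σ s + s) = 0 := by
    have e : (σ s - s) * (σ s + s) = σ (s ^ 2) - s ^ 2 := by rw [map_pow]; ring
    rw [e, hs, sub_self]
  rcases mul_eq_zero.mp h with h1 | h1
  · exact Or.inl (sub_eq_zero.mp h1)
  · exact Or.inr (add_eq_zero_iff_eq_neg.mp h1)

include hw in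
/-- `|x|_v < 1` in `K̄_v` for a global integer `x ∈ v`. [folklore] -/
private theorem spectralValuation_algebraMap_ringOfIntegers_lt_one {x : 𝓞 K} (hx : x ∈ v.asIdeal) :
    w (algebraMap (𝓞 K) (AlgebraicClosure (v.adicCompletion K)) x) < 1 := by
  rw [algebraMap_ringOfIntegers_algClosure_apply, ← NNReal.coe_lt_coe,
    coe_spectralValuation_algebraMap hw, NNReal.coe_one, Valued.toNormedField.norm_lt_one_iff,
    valuedAdicCompletion_eq_valuation']
  exact (v.valuation_lt_one_iff_mem x).mpr hx

include hw in
/-- **Odd residue characteristic**: an element of the inertia group `I_𝔐` fixing `s²` fixes `s`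
as soon as `|s|_v = 1` and `|2|_v = 1` (`σ s = −s` would give `|σ s − s|_v = |2s|_v = 1`,
against `|σ s − s|_v < 1` for `σ ∈ I_𝔐`, Neukirch II (9.3)). [cite: NeukirchANT1999, Ch. II (9.3)] -/
private theorem smul_eq_of_mem_inertia_of_two {𝔐 : Ideal v.localAbsIntegers} (h𝔐 : 𝔐 ∈ v.localPrimesAbove)
    {σ : absoluteGaloisGroup (v.adicCompletion K)}
    (hσ : σ ∈ 𝔐.inertia (absoluteGaloisGroup (v.adicCompletion K)))
    (h2 : w (2 : AlgebraicClosure (v.adicCompletion K)) = 1)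
    {s : AlgebraicClosure (v.adicCompletion K)} (hs : w s = 1)
    (hσs : σ • s = s ∨ σ • s = -s) : σ • s = s := by
  rcases hσs with h | h
  · exact h
  · exfalso
    have hlt := (mem_inertia_iff_spectralValuation hw h𝔐).mp hσ s hs.le
    rw [h, show -s - s = -(2 * s) by ring, Valuation.map_neg, map_mul, h2, hs, one_mul] at hlt
    exact lt_irrefl _ hlt

include hw in
/-- **Residue characteristic `2`**: an element `σ` of the inertia group `I_𝔐` with `σ s = ±s`
fixes `s` as soon as `s² = 1 + 4δ` with `|δ|_v ≤ 1` and `|2|_v < 1`: `x = (1 + s)/2` is a root of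
`X² − X − δ`, hence `|x|_v ≤ 1`, and `σ s = −s` would give `|σ x − x|_v = |s|_v = 1` (the argument
of `X2.TateTwistUnramifiedAtTwo` over `ℚ`). [cite: NeukirchANT1999, Ch. II (9.3)] -/
private theorem smul_eq_of_mem_inertia_of_sq_eq_one_add_four_mul {𝔐 : Ideal v.localAbsIntegers}
    (h𝔐 : 𝔐 ∈ v.localPrimesAbove) {σ : absoluteGaloisGroup (v.adicCompletion K)}
    (hσ : σ ∈ 𝔐.inertia (absoluteGaloisGroup (v.adicCompletion K)))
    (h2 : w (2 : AlgebraicClosure (v.adicCompletion K)) < 1)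
    {s δ : AlgebraicClosure (v.adicCompletion K)} (hδ : w δ ≤ 1)
    (hs : s ^ 2 = 1 + 4 * δ) (hσs : σ • s = s ∨ σ • s = -s) : σ • s = s := by
  haveI : CharZero (AlgebraicClosure (v.adicCompletion K)) :=
    charZero_of_injective_algebraMap (algebraMap K _).injective
  -- `|s|_v = 1`
  have hws : w s = 1 := by
    have h4δ : w (4 * δ) < 1 := by
      rw [show (4 : AlgebraicClosure (v.adicCompletion K)) = 2 * 2 by norm_num, map_mul, map_mul]
      calc w 2 * w 2 * w δ ≤ w 2 * w 2 * 1 := mul_le_mul_right hδ _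
        _ = w 2 * w 2 := mul_one _
        _ < 1 := mul_lt_one_of_nonneg_of_lt_one_left zero_le h2 h2.le
    have h1 : w (s ^ 2) = 1 := by rw [hs, Valuation.map_one_add_of_lt w h4δ]
    rw [map_pow] at h1
    exact (pow_eq_one_iff_of_nonneg zero_le two_ne_zero).mp h1
  -- `x = (1 + s)/2` is a root of `X² − X − δ`, hence integral
  set x : AlgebraicClosure (v.adicCompletion K) := (1 + s) / 2 with hx
  have hxeq : x ^ 2 = x + δ := by
    have e : δ = (s ^ 2 - 1) / 4 := by rw [hs]; ring
    rw [e, hx]; field_simp; ring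
  have hwx : w x ≤ 1 := by
    by_contra hgt
    rw [not_le] at hgt
    have h1 : w (x ^ 2) ≤ w x := by
      rw [hxeq]
      exact (Valuation.map_add w x δ).trans (max_le le_rfl (hδ.trans hgt.le))
    rw [map_pow, pow_two] at h1
    have hpos : 0 < w x := lt_trans zero_lt_one hgt
    have : w x * w x ≤ w x * 1 := by rw [mul_one]; exact h1
    exact absurd (le_of_mul_le_mul_left this hpos) (not_le.mpr hgt)
  rcases hσs with h | h
  · exact h
  · exfalso
    have hlt := (mem_inertia_iff_spectralValuation hw h𝔐).mp hσ x hwx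
    have hσx : σ • x = (1 - s) / 2 := by
      have hs' : absoluteGaloisGroup.toAlgEquiv (v.adicCompletion K) σ s = -s := h
      change absoluteGaloisGroup.toAlgEquiv (v.adicCompletion K) σ x = _
      rw [hx, map_div₀, map_add, map_one, map_ofNat, hs', ← sub_eq_add_neg]
    rw [hσx, hx, show (1 - s) / 2 - (1 + s) / 2 = -s by ring, Valuation.map_neg, hws] at hlt
    exact lt_irrefl _ hlt

/-! ## The main theorem -/

/-- **At a place of multiplicative reduction the inertia group fixes `√γ(E/K)`** (Silverman,
*ATAEC*, Ch. V: Lemma 5.2, Thm. 5.3 (b) and Ex. 5.11 — `E` with `|j|_v > 1` is the twist of the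
Tate curve `E_q` by the character of `K_v(√γ)/K_v`, `γ = γ(E/K) = −c₄/c₆`, and "`E` has
multiplicative reduction if and only if `K_v(√γ)/K_v` is unramified"). For an elliptic curve `W`
over a number field `K` with multiplicative reduction (split or non-split) at the finite place
`v`, every `t ∈ K̄_v` with `t² = −c₄(W)/c₆(W)` is fixed by the inertia group `I_𝔐 ≤ Γ_{K_v}`:
this is the hypothesis under which the twisted uniformisation
`Silverman1994_thmV53_corV54_tateUniformisation` is `I_𝔐`-EQUIVARIANT. Proof: see the module
docstring (minimal model, `c₄, c₆ ∈ 𝓞_v^×`; `v ∤ 2`: `|2s|_v = 1`; `v ∣ 2`: `−c₄c₆ = a₁^{10} + 4T`,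
`x = (1 + s')/2` integral). [cite: SilvermanATAEC1994, Ch. V Thm. 5.3 (b) and Ex. 5.11 (PDF pp. 407–412)] -/
theorem toAlgEquiv_eq_of_mem_inertia_of_sq_eq_gamma (W : WeierstrassCurve K) [W.IsElliptic]
    (hmult : W.HasMultiplicativeReductionAt v) {𝔐 : Ideal v.localAbsIntegers}
    (h𝔐 : 𝔐 ∈ v.localPrimesAbove) {t : AlgebraicClosure (v.adicCompletion K)}
    (ht : t ^ 2 = algebraMap (v.adicCompletion K) (AlgebraicClosure (v.adicCompletion K))
      (algebraMap K (v.adicCompletion K) (-(W.c₄ / W.c₆))))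
    {σ : absoluteGaloisGroup (v.adicCompletion K)}
    (hσ : σ ∈ 𝔐.inertia (absoluteGaloisGroup (v.adicCompletion K))) :
    absoluteGaloisGroup.toAlgEquiv (v.adicCompletion K) σ t = t := by
  obtain ⟨w, hw⟩ := v.exists_spectralValuation
  haveI : CharZero (AlgebraicClosure (v.adicCompletion K)) :=
    charZero_of_injective_algebraMap (algebraMap K _).injective
  -- notation
  let ι : v.adicCompletion K →+* AlgebraicClosure (v.adicCompletion K) :=
    algebraMap (v.adicCompletion K) (AlgebraicClosure (v.adicCompletion K))
  let φ : v.adicCompletionIntegers K →+* AlgebraicClosure (v.adicCompletion K) :=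
    ι.comp (algebraMap (v.adicCompletionIntegers K) (v.adicCompletion K))
  let τ : AlgebraicClosure (v.adicCompletion K) ≃ₐ[v.adicCompletion K]
      AlgebraicClosure (v.adicCompletion K) := absoluteGaloisGroup.toAlgEquiv (v.adicCompletion K) σ
  have hτ : ∀ y, σ • y = τ y := fun _ ↦ rfl
  have hτι : ∀ a, τ (ι a) = ι a := fun a ↦ τ.commutes a
  have hτφ : ∀ a, τ (φ a) = φ a := fun a ↦ τ.commutes _
  have hwφ : ∀ a, w (φ a) ≤ 1 := fun a ↦
    (spectralValuation_algebraMap_le_one_iff hw _).mpr a.2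
  -- the minimal model at `v`: `c₄`, `c₆` are units, `Δ ∈ 𝓂_v`
  set M : WeierstrassCurve (v.adicCompletionIntegers K) := W.localMinimalIntegralModel v with hMdef
  have hmult' : (W.localMinimalModel v).HasMultiplicativeReduction (v.adicCompletionIntegers K) :=
    hmult
  have hΔm : M.Δ ∈ maximalIdeal (v.adicCompletionIntegers K) := by
    have h := hmult'.badReduction
    rw [← WeierstrassCurve.integralModel_Δ_eq (v.adicCompletionIntegers K) (W.localMinimalModel v)] at h
    exact (valuation_lt_one_iff_mem _ _).mp h
  have hc₄m : M.c₄ ∉ maximalIdeal (v.adicCompletionIntegers K) := by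
    have h := hmult'.multiplicativeReduction
    rw [← WeierstrassCurve.integralModel_c₄_eq (v.adicCompletionIntegers K) (W.localMinimalModel v),
      valuation_of_algebraMap] at h
    exact intValuation_eq_one_iff.mp h
  have hc₄u : IsUnit M.c₄ := by
    by_contra h
    exact hc₄m ((IsLocalRing.mem_maximalIdeal _).mpr (mem_nonunits_iff.mpr h))
  have hc₆u : IsUnit M.c₆ := M.isUnit_c₆_of_Δ_mem_of_c₄_not_mem hΔm hc₄m
  have hw4 : w (φ M.c₄) = 1 := spectralValuation_eq_one_of_isUnit hw hc₄u
  have hw6 : w (φ M.c₆) = 1 := spectralValuation_eq_one_of_isUnit hw hc₆u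
  have h6ne : φ M.c₆ ≠ 0 := (Valuation.ne_zero_iff w).mp (by rw [hw6]; exact one_ne_zero)
  have h4ne : φ M.c₄ ≠ 0 := (Valuation.ne_zero_iff w).mp (by rw [hw4]; exact one_ne_zero)
  -- the change of variables `C • W_{K_v} = M`
  obtain ⟨C, hC⟩ := W.exists_variableChange_eq_localMinimalIntegralModel v
  have hbc4 : (W.baseChange (v.adicCompletion K)).c₄ = algebraMap K (v.adicCompletion K) W.c₄ :=
    W.map_c₄ _
  have hbc6 : (W.baseChange (v.adicCompletion K)).c₆ = algebraMap K (v.adicCompletion K) W.c₆ :=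
    W.map_c₆ _
  have hC4 : algebraMap (v.adicCompletionIntegers K) (v.adicCompletion K) M.c₄ =
      (↑C.u⁻¹ : v.adicCompletion K) ^ 4 * algebraMap K (v.adicCompletion K) W.c₄ := by
    have h := congrArg WeierstrassCurve.c₄ hC
    simp only [WeierstrassCurve.variableChange_c₄, WeierstrassCurve.map_c₄, hbc4] at h
    rw [← hMdef] at h
    exact h.symm
  have hC6 : algebraMap (v.adicCompletionIntegers K) (v.adicCompletion K) M.c₆ =
      (↑C.u⁻¹ : v.adicCompletion K) ^ 6 * algebraMap K (v.adicCompletion K) W.c₆ := by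
    have h := congrArg WeierstrassCurve.c₆ hC
    simp only [WeierstrassCurve.variableChange_c₆, WeierstrassCurve.map_c₆, hbc6] at h
    rw [← hMdef] at h
    exact h.symm
  -- in `K̄_v`
  set uval : AlgebraicClosure (v.adicCompletion K) := ι (C.u : v.adicCompletion K) with huval
  set uinv : AlgebraicClosure (v.adicCompletion K) := ι (↑C.u⁻¹ : v.adicCompletion K) with huinv
  have huv : uval * uinv = 1 := by
    rw [huval, huinv, ← map_mul, Units.mul_inv, map_one]
  have huval0 : uval ≠ 0 := left_ne_zero_of_mul_eq_one huv
  have huinv' : uinv = uval⁻¹ := eq_inv_of_mul_eq_one_right huv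
  set c4 : AlgebraicClosure (v.adicCompletion K) := ι (algebraMap K (v.adicCompletion K) W.c₄) with hc4
  set c6 : AlgebraicClosure (v.adicCompletion K) := ι (algebraMap K (v.adicCompletion K) W.c₆) with hc6
  have hm4 : φ M.c₄ = uinv ^ 4 * c4 := by
    change ι (algebraMap _ _ M.c₄) = _
    rw [hC4, map_mul, map_pow]
  have hm6 : φ M.c₆ = uinv ^ 6 * c6 := by
    change ι (algebraMap _ _ M.c₆) = _
    rw [hC6, map_mul, map_pow]
  have hc6ne : c6 ≠ 0 := by
    intro h0
    rw [h0, mul_zero] at hm6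
    exact h6ne hm6
  have ht' : t ^ 2 = -c4 / c6 := by
    rw [ht, map_neg, map_div₀, map_neg, map_div₀, hc4, hc6, neg_div]
  -- `s = t · u_C`, `s² = −c₄(M)/c₆(M)`
  set s : AlgebraicClosure (v.adicCompletion K) := t * uval with hsdef
  have hs2 : s ^ 2 = -(φ M.c₄) / φ M.c₆ := by
    rw [hsdef, mul_pow, ht', hm4, hm6, huinv']
    field_simp
  have hτs2 : τ (s ^ 2) = s ^ 2 := by rw [hs2, map_div₀, map_neg, hτφ, hτφ]
  have hσs : σ • s = s ∨ σ • s = -s := algEquiv_eq_or_eq_neg_of_sq τ hτs2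
  -- the key step: `σ s = s`
  have key : σ • s = s := by
    by_cases h2v : (2 : 𝓞 K) ∈ v.asIdeal
    · -- residue characteristic `2`
      have h2 : w (2 : AlgebraicClosure (v.adicCompletion K)) < 1 := by
        have h := spectralValuation_algebraMap_ringOfIntegers_lt_one hw h2v
        rwa [map_ofNat] at h
      -- `a₁` is a unit: `c₄ = a₁⁴ + 2T'`
      obtain ⟨T', hT'⟩ : ∃ T' : v.adicCompletionIntegers K, M.c₄ = M.a₁ ^ 4 + 2 * T' :=
        ⟨_, M.c₄_eq_a₁_pow_four_add_two_mul⟩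
      have ha4 : w (φ M.a₁ ^ 4) = 1 := by
        have e : φ M.a₁ ^ 4 = φ M.c₄ + -(2 * φ T') := by
          rw [hT', map_add, map_mul, map_pow, map_ofNat]; ring
        have hlt : w (-(2 * φ T')) < w (φ M.c₄) := by
          rw [Valuation.map_neg, map_mul, hw4]
          calc w 2 * w (φ T') ≤ w 2 * 1 := mul_le_mul_right (hwφ T') _
            _ < 1 := by rw [mul_one]; exact h2
        rw [e, Valuation.map_add_eq_of_lt_left w hlt, hw4]
      have hwa : w (φ M.a₁) = 1 := by
        rw [map_pow] at ha4
        exact (pow_eq_one_iff_of_nonneg zero_le (by norm_num)).mp ha4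
      have hane : φ M.a₁ ≠ 0 := (Valuation.ne_zero_iff w).mp (by rw [hwa]; exact one_ne_zero)
      -- `−c₄c₆ = a₁^{10} + 4T`
      obtain ⟨T, hT⟩ : ∃ T : v.adicCompletionIntegers K, -(M.c₄ * M.c₆) = M.a₁ ^ 10 + 4 * T :=
        ⟨_, M.neg_c₄_mul_c₆_eq⟩
      have hTφ : -(φ M.c₄ * φ M.c₆) = φ M.a₁ ^ 10 + 4 * φ T := by
        have h := congrArg φ hT
        rwa [map_neg, map_mul, map_add, map_mul, map_pow, map_ofNat] at h
      set δ : AlgebraicClosure (v.adicCompletion K) := φ T / φ M.a₁ ^ 10 with hδdef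
      have hwδ : w δ ≤ 1 := by
        rw [hδdef, map_div₀, map_pow, hwa, one_pow, div_one]
        exact hwφ T
      set s' : AlgebraicClosure (v.adicCompletion K) := s * φ M.c₆ / φ M.a₁ ^ 5 with hs'def
      have hs' : s' ^ 2 = 1 + 4 * δ := by
        rw [hs'def, div_pow, mul_pow, hs2, hδdef]
        have e : -(φ M.c₄) / φ M.c₆ * φ M.c₆ ^ 2 = -(φ M.c₄ * φ M.c₆) := by
          field_simp
        rw [e, hTφ]
        field_simp
      have hτs'2 : τ (s' ^ 2) = s' ^ 2 := by
        rw [hs', map_add, map_one, map_mul, map_ofNat, hδdef, map_div₀, map_pow, hτφ, hτφ]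
      have hσs' : σ • s' = s' ∨ σ • s' = -s' := algEquiv_eq_or_eq_neg_of_sq τ hτs'2
      have hfix' : σ • s' = s' :=
        smul_eq_of_mem_inertia_of_sq_eq_one_add_four_mul hw h𝔐 hσ h2 hwδ hs' hσs'
      -- unwind: `σ s' = σ s · c₆/a₁⁵`
      rw [hτ] at hfix' ⊢
      rw [hs'def, map_div₀, map_mul, map_pow, hτφ, hτφ] at hfix'
      have hden : φ M.a₁ ^ 5 ≠ 0 := pow_ne_zero _ hane
      have h1 : τ s * φ M.c₆ = s * φ M.c₆ := by
        have := congrArg (fun z ↦ z * φ M.a₁ ^ 5) hfix'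
        simp only [div_mul_cancel₀ _ hden] at this
        exact this
      exact mul_right_cancel₀ h6ne h1
    · -- odd residue characteristic
      have h2 : w (2 : AlgebraicClosure (v.adicCompletion K)) = 1 := by
        have h := spectralValuation_algebraMap_ringOfIntegers_eq_one hw h2v
        rwa [map_ofNat] at h
      have hws : w s = 1 := by
        have h1 : w (s ^ 2) = 1 := by
          rw [hs2, map_div₀, Valuation.map_neg, hw4, hw6, div_one]
        rw [map_pow] at h1
        exact (pow_eq_one_iff_of_nonneg zero_le two_ne_zero).mp h1
      exact smul_eq_of_mem_inertia_of_two hw h𝔐 hσ h2 hws hσs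
  -- unwind: `σ s = σ t · u_C`
  rw [hτ, hsdef, map_mul, hτι] at key
  exact mul_right_cancel₀ huval0 key

end Literature.NumberTheory.EllipticCurves.TateCurve
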